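import Summits.BirchSwinnertonDyer.BirchSwinnertonDyer.Theses.UniversalToricDescent
import Summits.BirchSwinnertonDyer.BirchSwinnertonDyer.Theorems.UniversalToricDescentToricTransportModThreeStubRatSqueeze
import Literature.NumberTheory.DiophantineGeometry.LocalReduction
import Literature.NumberTheory.GaloisRepresentations.AbsGaloisGroup
import HarnessLib

/-!
# Line `cubic_unwinding` — crux `AdditiveSplitIMCInclusionAtThree` (stmt-BirchSwinnertonDyer-20395, THE WALL, UTD)
# NODE of crux idea `cubic-unwinding` (cruxidea-stmt-BirchSwinnertonDyer-20395-1 gen 5, 2026-08-30).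

THE LEVER (two sentences).  On the sub-cell of `ClassO6 W 3` with CYCLIC cubic inertial type at `3` (Kraus `Φ = C₃`:
`π_{f,3} = PS(μχ, μ⁻¹χ⁻¹)`, `μ` the cubic character of `ℤ₃^×` of conductor `9`; `a₃(f_E) = 0`, `v₃(N) = 4`) the curve
acquires GOOD SUPERSINGULAR reduction over the first cyclotomic layer `ℚ(ζ₉)⁺` (`N(𝒪^×_{ℚ₃(ζ₉)⁺}) = {±1}(1+9ℤ₃) = ker μ`),
hence over the CM sextic `L = K·ℚ(ζ₉)⁺`; upstairs, over `L_∞ = L·K_∞^{ac}`, the three obstructions of the crux (no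
`U₃`-refinement, TRACE-ZERO Heegner tower, no reciprocity law at an additive fibre) are absent — level `1` at `𝔓`, a
three-term CM tower with `N𝔓 = 3`, a crystalline local representation — so the RATIONAL `(∅,0)` Kolyvagin inclusion is a
Kobayashi–Ota-type statement (sign-free Perrin-Riou twist, de Rham `(φ,Γ)`-theory over the ramified base), and it
DESCENDS character-by-character along `Gal(L/K) = C₃` (`E(L_∞)[3] = 0`, `ℚ₃[C₃]` semisimple) onto EXACTLY the rational
wall of 24207 once the two finite-slope SHADOWS `f ⊗ η^{±1}` (`η` the cubic Dirichlet character of conductor `9`) are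
peeled off by their Eisenstein inclusion; the integral wall then follows by `3`-saturation from the lineage's own μ-bit.

WHY NOVEL (one sentence).  None of the 14 cards / 4 skeletons of this crux changes the BASE FIELD — all keep `f_E`'s
additive fibre and hunt for an engine that survives it; this line removes the fibre on a named sub-cell by the one
solvable base change that makes `E` crystalline at `3`, pays for `3 ∣ [L:K]` only in the μ-currency the lineage already
mints separately (g2/g3), and is the first line here whose Euler system upstairs is an honest norm-compatible CM family.

PIECES (tags per the NODE contract; evidence in `Lines/cubic_unwinding.md`):
* T1 `WallOffCubicRows`        — WEAKER (the crux restricted to `¬ CubicRow W`: the `C₆` and dicyclic rows; IDEA-NEEDED leaf,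
                                  served by every other live line unchanged).
* T2 `SelfMuZeroOnCubicRows`   — WEAKER (g3's `SelfAlgMuZeroAtThree` restricted to cubic rows; = the μ-bit; fed by the
                                  toothwise children or by 24737 twin transport; UNDECIDED there, not here).
* T3 `CubicLiftExists`         — WEAKER·ATTACKABLE (M): field/character bookkeeping (`L = K·F`, `κ_L = κ ∘ res`, `η`).
* T4 `ShadowPairExists`        — WEAKER·ATTACKABLE-from-print modulo one typing caveat (the `𝔭`-multiplier of a BDP
                                  function at a `𝔭`-RAMIFIED twist; see the docstring): existence and non-vanishing of the
                                  shadow pair function `S = L_𝔭(f⊗η)·L_𝔭(f⊗η̄)`.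
* T5 `LiftedRationalInclusion` — UNDECIDED, THE research kernel: rational `(∅,0)` Kolyvagin inclusion for `E/L_∞` with
                                  analytic side `L·S` (Artin factorisation built in).  Leaves: (a) CM points of `L` on the
                                  Shimura curve over `ℚ(ζ₉)⁺` + three-term relations [ATTACKABLE: Zhang01/CV07];
                                  (b) rational Λ-adic class via Perrin-Riou/Nakamura over `ℚ₃(ζ₉)⁺` [UNDECIDED: KO20 is over
                                  `ℚ_p`]; (c) KS bound over `L` at `3` [barrier EulerSystemBigImageAtSmallImage, same bet as
                                  thin_comb K2(c)]; (d) reciprocity law / p-adic Waldspurger over `ℚ(ζ₉)⁺` with `3` ramified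
                                  [UNDECIDED]; (e) period/Artin matching with `L·S` [ATTACKABLE].
* T6 `CubicDescent`            — UNDECIDED = (a) exact Galois descent `⊗ℚ₃` [ATTACKABLE now] + (b) λ-multiplicativity of
                                  characteristic ideals over isotypic parts [PROVABLE algebra] + (c) SHADOW EISENSTEIN
                                  inclusion at `9 ∣ N`, `π₃ = PS(unr, ram)` [UNDECIDED; candidate feed: g4's
                                  `stub_twoVarEisenstein` / SOED's semi-ordinary engine specialised to the two level-1 teeth].
* kernel `ratwall_on_cubic_rows`, `AdditiveSplitIMCInclusionAtThree_of` — PROVED below (no sorry), conclude the crux BY NAME.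

Nothing here is a theorem about elliptic curves beyond the compositions; BSD is not advanced by this file.
References: Kobayashi–Ota, ASPM 86 (2020) [doi:10.2969/aspm/08610537]; Nakamura, JIMJ 13 (2014) [arXiv:1201.6475];
Kraus, Manuscripta Math. 69 (1990); Hachimori–Matsuno, J. Alg. Geom. 8 (1999); Zhang, Ann. Math. 153 (2001);
Cornut–Vatsal in [Burns–Buzzard–Nekovář 2007]; Castella 2018 / Castella–Hsieh 2018 (tree `IsBDPLFunction`);
[Washington1997] §7.1, §13; arXiv:2211.04377 (integral KO); arXiv:2407.08430 p.4 (± theory needs unramified base).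
-/

set_option linter.dupNamespace false
set_option autoImplicit false

noncomputable section

open Literature.NumberTheory.EllipticCurves
open Literature.NumberTheory.GaloisRepresentations
open Summit.BirchSwinnertonDyer.BirchSwinnertonDyer.Theses.UniversalToricDescent
  (RationalSplitIMCInclusionAtThree AdditiveSplitIMCInclusionAtThree)
open Summit.BirchSwinnertonDyer.BirchSwinnertonDyer.Cruxes.ToricTransportModThree.RatwallThinComb
  (dvd_of_dvd_prime_pow_mul prime_C_three not_C_three_dvd_of_norm_coeff_eq_one)
open Summit.BirchSwinnertonDyer.Rank1Residual.X11b
open IsDedekindDomain NumberField Field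

namespace Summit.BirchSwinnertonDyer.BirchSwinnertonDyer.Cruxes.AdditiveSplitIMCInclusionAtThree.CubicUnwinding

/-! ## §0 Objects -/

/-- The Φ = C₃ ROW PREDICATE: some cyclic cubic field `F` (cyclic cubic fields are totally real) makes `E/F` have
GOOD reduction at every prime above `3`.  By local class field theory this holds iff the inertial type of `E` at `3`
is `μ ⊕ μ⁻¹` with `μ` cubic of conductor `9` (then EVERY `3`-ramified cyclic cubic `F` works, in particular
`F = ℚ(ζ₉)⁺`, the first layer of the cyclotomic `ℤ₃`-extension); it fails on the `C₆` and dicyclic (supercuspidal)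
rows of `ClassO6 W 3`.  [Kraus 1990, Thm. 1 (p = 3); Serre–Tate] -/
def CubicRow (W : WeierstrassCurve ℚ) : Prop :=
  ∃ (F : Type) (_ : Field F) (_ : NumberField F),
    Module.finrank ℚ F = 3 ∧ IsGalois ℚ F ∧
      ∀ w : HeightOneSpectrum (𝓞 F), ((3 : ℕ) : 𝓞 F) ∈ w.asIdeal → (W.baseChange F).HasGoodReductionAt w

/-- The CUBIC LIFT DATUM as a predicate (no new structure, no instance): `L ⊇ K` cubic Galois, `L/ℚ` abelian (so
`L = K·F` with `F = L^{c=1}` cyclic cubic totally real and `L` is CM), `E/L` good above `3`, `κ_L = κ ∘ res_{L/K}`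
(the `ℤ₃`-extension `L_∞ = L·K_∞` of `L`), `𝔓, 𝔓'` THE primes of `L` over `𝔭, 𝔭'` (total ramification), and `η` a
cubic Hecke character of `K` cutting out `L` (`η(v) = 1 ↔ v` splits completely, at unramified `v ∤ 3`).
[folklore; Washington1997 §13; Neukirch ANT VI] -/
def IsCubicLift (W : WeierstrassCurve ℚ) (K : Type) [Field K] [NumberField K] (L : Type) [Field L]
    [NumberField L] [Algebra K L] (κ : ZpExtension K 3) (κL : ZpExtension L 3)
    (𝔭 𝔭' : HeightOneSpectrum (𝓞 K)) (𝔓 𝔓' : HeightOneSpectrum (𝓞 L)) (η : HeckeCharacter K) : Prop :=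
  Module.finrank K L = 3 ∧ IsGalois K L ∧ IsGalois ℚ L ∧ (∀ σ τ : L ≃ₐ[ℚ] L, σ * τ = τ * σ) ∧
  (∀ w : HeightOneSpectrum (𝓞 L), ((3 : ℕ) : 𝓞 L) ∈ w.asIdeal → (W.baseChange L).HasGoodReductionAt w) ∧
  (∀ σ : absoluteGaloisGroup L, κL σ = κ (absGaloisRestrict K L σ)) ∧
  𝔓.asIdeal.comap (algebraMap (𝓞 K) (𝓞 L)) = 𝔭.asIdeal ∧
  𝔓'.asIdeal.comap (algebraMap (𝓞 K) (𝓞 L)) = 𝔭'.asIdeal ∧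
  η ^ 3 = 1 ∧ η ≠ 1 ∧
  (∀ v : HeightOneSpectrum (𝓞 K), ((3 : ℕ) : 𝓞 K) ∉ v.asIdeal →
     η.IsUnramifiedAt v ∧ (η.valueAtUniformizer v = 1 ↔ (v.asIdeal.primesOver (𝓞 L)).ncard = 3))

variable {K : Type} [Field K] [NumberField K] {N : ℕ}

/-- The complex interpolation value of the BDP function of the TWISTED newform `g = f ⊗ η` at an unramified
anticyclotomic `φ` of infinity type `(n, −n)`: Castella's value (tree `bdpInterpolationValue`) with
`L(f/K, φ·η_K, 1) = L(g/K, φ, 1)` (so no nebentypus cusp-form type is needed) and the `𝔭`-multiplier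
`(1 − α·3⁻¹·φ(𝔭))²`, `α = a₃(g)` = the crystalline Frobenius eigenvalue of `E/ℚ₃(ζ₉)⁺` on the `η`-line
(`α + β = a_w ∈ {0, ±3}`, `αβ = 3`).  TYPING CAVEAT (for the crux-plan seat): the printed interpolation formulae
(BDP13 §5, Castella–Hsieh18 Prop. 3.8, Hsieh14 Thm. A) carry, for a `𝔭`-RAMIFIED twist, root-number / Gauss-sum
constants; `φ`- and `n`-INDEPENDENT constants are absorbed by `c` in `IsShadowPairLFunction`, `cⁿ`-type factors by the
free periods; a residual `φ(𝔭)`-power would have to be added here (the kernel below is insensitive to the predicate's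
body).  [cite: Castella2018, Thm. 3.1] [BDP13 Thm. 5.13] -/
def twistedValue (f : CuspForm (CongruenceSubgroup.Gamma0 N) 2) (𝔭 : HeightOneSpectrum (𝓞 K))
    (η : HeckeCharacter K) (α : ℂ) (φ : HeckeCharacter K) (n : ℕ) (ΩK : ℂ) : ℂ :=
  let φ𝔭 : ℂ := heckeValueExtZero φ 𝔭
  Complex.Gamma n * Complex.Gamma (n + 1) * (1 - α * ((3 : ℂ))⁻¹ * φ𝔭) ^ 2 *
    rankinSelbergValueHecke f (φ * η) 1 / ((Real.pi : ℂ) ^ (2 * n + 1) * ΩK ^ (4 * n))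

/-- The SHADOW PAIR FUNCTION predicate: `S ∈ R₀⟦T⟧` interpolates, at the same points as `IsBDPLFunction`, the PRODUCT of
the twisted values for `η` and `η⁻¹` (the product has Galois-conjugation-invariant coefficients, hence unramified —
a single twist would live in `R₀[ζ₃]⟦T⟧`), up to a non-zero constant `c` and with `{α, β}` the Frobenius eigenvalues
of the good supersingular fibre upstairs.  Meant: `S ≐ L_𝔭(f⊗η)·L_𝔭(f⊗η̄)`.  [cite: Castella2018, Thm. 3.1] -/
def IsShadowPairLFunction (ι : PadicAlgCl 3 ≃+* ℂ) (𝔭 : HeightOneSpectrum (𝓞 K)) (κ : ZpExtension K 3)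
    (γ : absoluteGaloisGroup K) (f : CuspForm (CongruenceSubgroup.Gamma0 N) 2) (η : HeckeCharacter K)
    (ΩK : ℂ) (Ωp : ℂ_[3]) (S : UnrSeries 3) : Prop :=
  ∃ (c α β : ℂ), c ≠ 0 ∧ α * β = 3 ∧ (α + β = 0 ∨ α + β = 3 ∨ α + β = -3) ∧
  ∀ (φ : HeckeCharacter K) (n : ℕ), 0 < n → (∀ v : HeightOneSpectrum (𝓞 K), φ.IsUnramifiedAt v) →
    φ.HasInfinityType (fun _ ↦ (n : ℤ)) (fun _ ↦ -(n : ℤ)) →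
    ∀ r : FramedGaloisRep K (PadicAlgCl 3) 1, IsPAdicAvatarOf ι φ r → FactorsThroughZp κ r →
      S.HasValueAt (avatarValueAt r γ - 1)
        (((ι.symm (c * twistedValue f 𝔭 η α φ n ΩK * twistedValue f 𝔭 η⁻¹ β φ n ΩK) :
            PadicAlgCl 3) : ℂ_[3]) * Ωp ^ (8 * n))

/-! ## §1 The six pieces -/

/-- T1 (WEAKER; the complementary rows — `C₆` and dicyclic inertia — IDEA-NEEDED leaf, served by every other live line
verbatim): the crux restricted to `¬ CubicRow W`. -/
def WallOffCubicRows : Prop :=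
  ∀ (W : WeierstrassCurve ℚ) [W.IsElliptic] [W.IsGloballyMinimal], ¬ CubicRow W → ∀ (N : ℕ) [NeZero N] (K : Type) [Field K] [NumberField K] (Dt : Literature.NumberTheory.EllipticCurves.ModularForms.ModularParametrizationData W N), Summit.BirchSwinnertonDyer.Rank1Residual.Additive.ClassO6 W 3 → W.HasSurjectiveModNGaloisRep 3 → W.analyticRank = 1 → W.conductorNorm ℤ = N → Literature.NumberTheory.EllipticCurves.IsImaginaryQuadratic K → Literature.NumberTheory.EllipticCurves.SatisfiesHeegnerHypothesis N K → ∀ (κ : Literature.NumberTheory.EllipticCurves.ZpExtension K 3), κ.IsAnticyclotomic → ∀ (γ : Field.absoluteGaloisGroup K) [Fact (κ.IsTopGenerator γ)] (𝔭 : IsDedekindDomain.HeightOneSpectrum (NumberField.RingOfIntegers K)), ((3 : ℕ) : NumberField.RingOfIntegers K) ∈ 𝔭.asIdeal → 𝔭.asIdeal.ramificationIdx (NumberField.RingOfIntegers ℚ) = 1 → 𝔭.asIdeal.inertiaDeg (NumberField.RingOfIntegers ℚ) = 1 → ∀ (𝔭' : IsDedekindDomain.HeightOneSpectrum (NumberField.RingOfIntegers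 K)), ((3 : ℕ) : NumberField.RingOfIntegers K) ∈ 𝔭'.asIdeal → 𝔭' ≠ 𝔭 → ∀ (ι' : PadicAlgCl 3 ≃+* ℂ), Summit.BirchSwinnertonDyer.BirchSwinnertonDyer.Theorems.SchneiderFree.BranchInducesPrime 3 ι' 𝔭 → ∀ (ΩK : ℂ) (Ωp : ℂ_[3]) (L : Literature.NumberTheory.EllipticCurves.UnrSeries 3), ΩK ≠ 0 → Ωp ≠ 0 → Literature.NumberTheory.EllipticCurves.IsBDPLFunction ι' 𝔭 κ γ Dt.f ΩK Ωp L → Ideal.span {L} ≤ (Summit.BirchSwinnertonDyer.Rank1Residual.X11b.AcSelmer.XAc.charIdeal (W.baseChange K) 3 κ 𝔭' ∅ γ).map (PowerSeries.map (Summit.BirchSwinnertonDyer.Rank1Residual.X11b.Halves.toUnr 3))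

/-- T2 (WEAKER; = the lineage's μ-bit restricted to cubic rows, in g3's `SelfAlgMuZeroAtThree` currency): `X_(∅,0)(E/K_∞)`
strict at `𝔭'` is Λ-torsion and `Ch·R₀⟦T⟧ = (g')` with a coefficient of norm `1` (μ = 0).  Needed because `ℤ₃[C₃]` is
not semisimple: μ-parts do not descend along the cubic layer (e.g. `M = Λ'/(π)` with trivial `C₃`-action has
`μ_{Λ'}(M) = 1`, `μ_Λ(M_{C₃}) = 3`).  [GreenbergVatsal2000 Prop. 2.8; Hachimori–Matsuno 1999] -/
def SelfMuZeroOnCubicRows : Prop :=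
  ∀ (W : WeierstrassCurve ℚ) [W.IsElliptic] [W.IsGloballyMinimal], CubicRow W → ∀ (N : ℕ) [NeZero N] (K : Type) [Field K]
    [NumberField K] (Dt : Literature.NumberTheory.EllipticCurves.ModularForms.ModularParametrizationData W N),
    Summit.BirchSwinnertonDyer.Rank1Residual.Additive.ClassO6 W 3 → W.HasSurjectiveModNGaloisRep 3 →
    W.analyticRank = 1 → W.conductorNorm ℤ = N → Literature.NumberTheory.EllipticCurves.IsImaginaryQuadratic K →
    Literature.NumberTheory.EllipticCurves.SatisfiesHeegnerHypothesis N K →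
    ∀ (κ : Literature.NumberTheory.EllipticCurves.ZpExtension K 3), κ.IsAnticyclotomic →
    ∀ (γ : Field.absoluteGaloisGroup K) [Fact (κ.IsTopGenerator γ)]
      (𝔭 : IsDedekindDomain.HeightOneSpectrum (NumberField.RingOfIntegers K)),
      ((3 : ℕ) : NumberField.RingOfIntegers K) ∈ 𝔭.asIdeal →
      𝔭.asIdeal.ramificationIdx (NumberField.RingOfIntegers ℚ) = 1 →
      𝔭.asIdeal.inertiaDeg (NumberField.RingOfIntegers ℚ) = 1 →
    ∀ (𝔭' : IsDedekindDomain.HeightOneSpectrum (NumberField.RingOfIntegers K)),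
      ((3 : ℕ) : NumberField.RingOfIntegers K) ∈ 𝔭'.asIdeal → 𝔭' ≠ 𝔭 →
    Module.IsTorsion (IwasawaAlgebra 3) (AcSelmer.XAc (W.baseChange K) 3 κ 𝔭' ∅ γ) ∧
      ∃ g' : UnrSeries 3,
        (AcSelmer.XAc.charIdeal (W.baseChange K) 3 κ 𝔭' ∅ γ).map (PowerSeries.map (Halves.toUnr 3)) =
            Ideal.span {g'} ∧
          ∃ i : ℕ, ‖((PowerSeries.coeff i g' : unrIntegers 3) : ℂ_[3])‖ = 1

/-- T3 (WEAKER·ATTACKABLE, M): existence of the cubic lift datum — `L := K·F` (`F` from `CubicRow W`; `K ∩ F = ℚ` since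
`F` is real), `κ_L := κ ∘ res` (surjective because `L ∩ K_∞ = K`: `K_∞/K` is unramified outside `3`… and `[L:K] = 3`
with `L ⊄ K_∞` as `L/ℚ` is abelian non-anticyclotomic), `γ_L` any element with `κ_L γ_L = 1`, `𝔓, 𝔓'` the unique
primes over the totally ramified `𝔭, 𝔭'`, `η` one of the two cubic characters of `Gal(L/K)` composed with Artin
reciprocity; `κ_L` is anticyclotomic for the CM field `L`.  [folklore; Washington1997 §13, Neukirch VI.5] -/
def CubicLiftExists : Prop :=
  ∀ (W : WeierstrassCurve ℚ) [W.IsElliptic], CubicRow W →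
  ∀ (K : Type) [Field K] [NumberField K], Literature.NumberTheory.EllipticCurves.IsImaginaryQuadratic K →
  ∀ (κ : ZpExtension K 3), κ.IsAnticyclotomic → ∀ (γ : absoluteGaloisGroup K), κ.IsTopGenerator γ →
  ∀ (𝔭 : HeightOneSpectrum (𝓞 K)), ((3 : ℕ) : 𝓞 K) ∈ 𝔭.asIdeal →
    𝔭.asIdeal.ramificationIdx (NumberField.RingOfIntegers ℚ) = 1 →
    𝔭.asIdeal.inertiaDeg (NumberField.RingOfIntegers ℚ) = 1 →
  ∀ (𝔭' : HeightOneSpectrum (𝓞 K)), ((3 : ℕ) : 𝓞 K) ∈ 𝔭'.asIdeal → 𝔭' ≠ 𝔭 →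
  ∃ (L : Type) (_ : Field L) (_ : NumberField L) (_ : Algebra K L) (κL : ZpExtension L 3)
    (γL : absoluteGaloisGroup L) (𝔓 𝔓' : HeightOneSpectrum (𝓞 L)) (η : HeckeCharacter K),
    IsCubicLift W K L κ κL 𝔭 𝔭' 𝔓 𝔓' η ∧ κL.IsTopGenerator γL ∧ κL.IsAnticyclotomic

/-- T4 (WEAKER·ATTACKABLE-from-print modulo the typing caveat of `twistedValue`): the shadow pair function exists for
some periods and is NON-ZERO (non-vanishing of `L(f⊗η/K, φ, 1)·L(f⊗η̄/K, φ, 1)` for some `φ` of type `(n,−n)`: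
Rohrlich / Cornut–Vatsal / Hsieh's μ-theorem shape).  [BDP13 Thm. 5.13; Hsieh14 Thm. C; CornutVatsal2005] -/
def ShadowPairExists : Prop :=
  ∀ (W : WeierstrassCurve ℚ) [W.IsElliptic] [W.IsGloballyMinimal] (N : ℕ) [NeZero N] (K : Type) [Field K]
    [NumberField K] (Dt : Literature.NumberTheory.EllipticCurves.ModularForms.ModularParametrizationData W N),
    Summit.BirchSwinnertonDyer.Rank1Residual.Additive.ClassO6 W 3 → W.HasSurjectiveModNGaloisRep 3 →
    W.analyticRank = 1 → W.conductorNorm ℤ = N → Literature.NumberTheory.EllipticCurves.IsImaginaryQuadratic K →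
    Literature.NumberTheory.EllipticCurves.SatisfiesHeegnerHypothesis N K →
    ∀ (κ : Literature.NumberTheory.EllipticCurves.ZpExtension K 3), κ.IsAnticyclotomic →
    ∀ (γ : Field.absoluteGaloisGroup K) [Fact (κ.IsTopGenerator γ)]
      (𝔭 : IsDedekindDomain.HeightOneSpectrum (NumberField.RingOfIntegers K)),
      ((3 : ℕ) : NumberField.RingOfIntegers K) ∈ 𝔭.asIdeal →
      𝔭.asIdeal.ramificationIdx (NumberField.RingOfIntegers ℚ) = 1 →
      𝔭.asIdeal.inertiaDeg (NumberField.RingOfIntegers ℚ) = 1 →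
    ∀ (𝔭' : IsDedekindDomain.HeightOneSpectrum (NumberField.RingOfIntegers K)),
      ((3 : ℕ) : NumberField.RingOfIntegers K) ∈ 𝔭'.asIdeal → 𝔭' ≠ 𝔭 →
    ∀ (ι' : PadicAlgCl 3 ≃+* ℂ),
      Summit.BirchSwinnertonDyer.BirchSwinnertonDyer.Theorems.SchneiderFree.BranchInducesPrime 3 ι' 𝔭 →
    ∀ (L : Type) [Field L] [NumberField L] [Algebra K L] (κL : ZpExtension L 3)
      (𝔓 𝔓' : HeightOneSpectrum (𝓞 L)) (η : HeckeCharacter K), IsCubicLift W K L κ κL 𝔭 𝔭' 𝔓 𝔓' η →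
    ∃ (ΩK' : ℂ) (Ωp' : ℂ_[3]) (S : UnrSeries 3),
      ΩK' ≠ 0 ∧ Ωp' ≠ 0 ∧ IsShadowPairLFunction ι' 𝔭 κ γ Dt.f η ΩK' Ωp' S ∧ S ≠ 0

/-- T5 (UNDECIDED — THE research kernel; strictly about `E` over the sextic `L`, not the crux): the RATIONAL `(∅,0)`
Kolyvagin inclusion upstairs, `3ᵏ·L·S ∈ Ch_Λ(X_(∅,0)(E/L_∞))·R₀⟦T⟧` (relaxed at `𝔓`, strict at `𝔓'`; balanced:
`2·[L_𝔓:ℚ₃] = 6 = [L:ℚ]`), with the Artin factorisation `ℒ_𝔓(E/L)|_{line} ≐ L·S` built into the statement.  Print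
analogue: Kobayashi–Ota 2020 (over `ℚ_p`, `p ∤ N`, non-ordinary allowed, `⊗ℚ_p`); new here: CM sextic base, `3`
ramified in the totally real subfield, supersingular.  [doi:10.2969/aspm/08610537; Zhang2001; arXiv:1201.6475] -/
def LiftedRationalInclusion : Prop :=
  ∀ (W : WeierstrassCurve ℚ) [W.IsElliptic] [W.IsGloballyMinimal] (N : ℕ) [NeZero N] (K : Type) [Field K]
    [NumberField K] (Dt : Literature.NumberTheory.EllipticCurves.ModularForms.ModularParametrizationData W N),
    Summit.BirchSwinnertonDyer.Rank1Residual.Additive.ClassO6 W 3 → W.HasSurjectiveModNGaloisRep 3 →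
    W.analyticRank = 1 → W.conductorNorm ℤ = N → Literature.NumberTheory.EllipticCurves.IsImaginaryQuadratic K →
    Literature.NumberTheory.EllipticCurves.SatisfiesHeegnerHypothesis N K →
    ∀ (κ : Literature.NumberTheory.EllipticCurves.ZpExtension K 3), κ.IsAnticyclotomic →
    ∀ (γ : Field.absoluteGaloisGroup K) [Fact (κ.IsTopGenerator γ)]
      (𝔭 : IsDedekindDomain.HeightOneSpectrum (NumberField.RingOfIntegers K)),
      ((3 : ℕ) : NumberField.RingOfIntegers K) ∈ 𝔭.asIdeal →
      𝔭.asIdeal.ramificationIdx (NumberField.RingOfIntegers ℚ) = 1 →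
      𝔭.asIdeal.inertiaDeg (NumberField.RingOfIntegers ℚ) = 1 →
    ∀ (𝔭' : IsDedekindDomain.HeightOneSpectrum (NumberField.RingOfIntegers K)),
      ((3 : ℕ) : NumberField.RingOfIntegers K) ∈ 𝔭'.asIdeal → 𝔭' ≠ 𝔭 →
    ∀ (ι' : PadicAlgCl 3 ≃+* ℂ),
      Summit.BirchSwinnertonDyer.BirchSwinnertonDyer.Theorems.SchneiderFree.BranchInducesPrime 3 ι' 𝔭 →
    ∀ (L : Type) [Field L] [NumberField L] [Algebra K L] (κL : ZpExtension L 3) (γL : absoluteGaloisGroup L)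
      [Fact (κL.IsTopGenerator γL)] (𝔓 𝔓' : HeightOneSpectrum (𝓞 L)) (η : HeckeCharacter K),
      IsCubicLift W K L κ κL 𝔭 𝔭' 𝔓 𝔓' η → κL.IsAnticyclotomic →
    ∀ (ΩK : ℂ) (Ωp : ℂ_[3]) (Lf : UnrSeries 3), ΩK ≠ 0 → Ωp ≠ 0 →
      Literature.NumberTheory.EllipticCurves.IsBDPLFunction ι' 𝔭 κ γ Dt.f ΩK Ωp Lf →
    ∀ (ΩK' : ℂ) (Ωp' : ℂ_[3]) (S : UnrSeries 3), ΩK' ≠ 0 → Ωp' ≠ 0 →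
      IsShadowPairLFunction ι' 𝔭 κ γ Dt.f η ΩK' Ωp' S →
    ∃ k : ℕ, ((3 : ℕ) : UnrSeries 3) ^ k * (Lf * S) ∈
      (AcSelmer.XAc.charIdeal (W.baseChange L) 3 κL 𝔓' ∅ γL).map (PowerSeries.map (Halves.toUnr 3))

/-- T6 (UNDECIDED = exact Galois descent `⊗ℚ₃` [ATTACKABLE] + λ-multiplicativity [PROVABLE] + SHADOW EISENSTEIN
inclusion `Ch(X(f⊗η ⊕ f⊗η̄)) ⊆ (S)·3^{−∞}` [UNDECIDED, `9 ∣ N`]): from the lifted rational inclusion and `S ≠ 0`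
to the rational wall for `E/K_∞`.  Mechanism: `E(L_∞)[3] = 0` (ρ̄ onto, `ℚ(E[3]) ∩ L_∞ = ℚ`) ⇒
`X(E/L_∞)_{C₃} → X(E/K_∞)` has finite kernel and cokernel; over `Λ' = Λ[ζ₃]`, `X_L ⊗ ℚ = X_K ⊕ X_η ⊕ X_{η̄}`;
λ-parts of characteristic ideals multiply; peel the shadows with their Eisenstein inclusion and `S ≠ 0` in the UFD
`R₀⟦T⟧ ⊗ ℚ`.  [Hachimori–Matsuno 1999 §3; GreenbergVatsal2000 §2; Washington1997 §13.2] -/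
def CubicDescent : Prop :=
  ∀ (W : WeierstrassCurve ℚ) [W.IsElliptic] [W.IsGloballyMinimal] (N : ℕ) [NeZero N] (K : Type) [Field K]
    [NumberField K] (Dt : Literature.NumberTheory.EllipticCurves.ModularForms.ModularParametrizationData W N),
    Summit.BirchSwinnertonDyer.Rank1Residual.Additive.ClassO6 W 3 → W.HasSurjectiveModNGaloisRep 3 →
    W.analyticRank = 1 → W.conductorNorm ℤ = N → Literature.NumberTheory.EllipticCurves.IsImaginaryQuadratic K →
    Literature.NumberTheory.EllipticCurves.SatisfiesHeegnerHypothesis N K →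
    ∀ (κ : Literature.NumberTheory.EllipticCurves.ZpExtension K 3), κ.IsAnticyclotomic →
    ∀ (γ : Field.absoluteGaloisGroup K) [Fact (κ.IsTopGenerator γ)]
      (𝔭 : IsDedekindDomain.HeightOneSpectrum (NumberField.RingOfIntegers K)),
      ((3 : ℕ) : NumberField.RingOfIntegers K) ∈ 𝔭.asIdeal →
      𝔭.asIdeal.ramificationIdx (NumberField.RingOfIntegers ℚ) = 1 →
      𝔭.asIdeal.inertiaDeg (NumberField.RingOfIntegers ℚ) = 1 →
    ∀ (𝔭' : IsDedekindDomain.HeightOneSpectrum (NumberField.RingOfIntegers K)),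
      ((3 : ℕ) : NumberField.RingOfIntegers K) ∈ 𝔭'.asIdeal → 𝔭' ≠ 𝔭 →
    ∀ (ι' : PadicAlgCl 3 ≃+* ℂ),
      Summit.BirchSwinnertonDyer.BirchSwinnertonDyer.Theorems.SchneiderFree.BranchInducesPrime 3 ι' 𝔭 →
    ∀ (L : Type) [Field L] [NumberField L] [Algebra K L] (κL : ZpExtension L 3) (γL : absoluteGaloisGroup L)
      [Fact (κL.IsTopGenerator γL)] (𝔓 𝔓' : HeightOneSpectrum (𝓞 L)) (η : HeckeCharacter K),
      IsCubicLift W K L κ κL 𝔭 𝔭' 𝔓 𝔓' η → κL.IsAnticyclotomic →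
    ∀ (ΩK : ℂ) (Ωp : ℂ_[3]) (Lf : UnrSeries 3), ΩK ≠ 0 → Ωp ≠ 0 →
      Literature.NumberTheory.EllipticCurves.IsBDPLFunction ι' 𝔭 κ γ Dt.f ΩK Ωp Lf →
    ∀ (ΩK' : ℂ) (Ωp' : ℂ_[3]) (S : UnrSeries 3), ΩK' ≠ 0 → Ωp' ≠ 0 →
      IsShadowPairLFunction ι' 𝔭 κ γ Dt.f η ΩK' Ωp' S → S ≠ 0 →
    (∃ k : ℕ, ((3 : ℕ) : UnrSeries 3) ^ k * (Lf * S) ∈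
      (AcSelmer.XAc.charIdeal (W.baseChange L) 3 κL 𝔓' ∅ γL).map (PowerSeries.map (Halves.toUnr 3))) →
    ∃ k : ℕ, ((3 : ℕ) : UnrSeries 3) ^ k * Lf ∈
      (AcSelmer.XAc.charIdeal (W.baseChange K) 3 κ 𝔭' ∅ γ).map (PowerSeries.map (Halves.toUnr 3))

/-! ## §2 Registered stubs -/

/-- Stub T1. -/
theorem stub_wallOffCubicRows : WallOffCubicRows := by
  sorry

/-- Stub T2. -/
theorem stub_selfMuZeroOnCubicRows : SelfMuZeroOnCubicRows := by
  sorry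

/-- Stub T3. -/
theorem stub_cubicLiftExists : CubicLiftExists := by
  sorry

/-- Stub T4. -/
theorem stub_shadowPairExists : ShadowPairExists := by
  sorry

/-- Stub T5. -/
theorem stub_liftedRationalInclusion : LiftedRationalInclusion := by
  sorry

/-- Stub T6. -/
theorem stub_cubicDescent : CubicDescent := by
  sorry

/-! ## §3 Kernel (PROVED): the rational wall on cubic rows, then the crux by name -/

/-- **RATWALL on the cubic rows** from T3–T6: lift, take the shadow pair, apply the lifted inclusion, descend.
Conclusion = 24207's conclusion shape, verbatim, under the extra hypothesis `CubicRow W`. [this file] -/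
theorem ratwall_on_cubic_rows (h3 : CubicLiftExists) (h4 : ShadowPairExists) (h5 : LiftedRationalInclusion)
    (h6 : CubicDescent) :
    ∀ (W : WeierstrassCurve ℚ) [W.IsElliptic] [W.IsGloballyMinimal], CubicRow W → ∀ (N : ℕ) [NeZero N] (K : Type)
    [Field K] [NumberField K] (Dt : Literature.NumberTheory.EllipticCurves.ModularForms.ModularParametrizationData W N),
    Summit.BirchSwinnertonDyer.Rank1Residual.Additive.ClassO6 W 3 → W.HasSurjectiveModNGaloisRep 3 →
    W.analyticRank = 1 → W.conductorNorm ℤ = N → Literature.NumberTheory.EllipticCurves.IsImaginaryQuadratic K →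
    Literature.NumberTheory.EllipticCurves.SatisfiesHeegnerHypothesis N K →
    ∀ (κ : Literature.NumberTheory.EllipticCurves.ZpExtension K 3), κ.IsAnticyclotomic →
    ∀ (γ : Field.absoluteGaloisGroup K) [Fact (κ.IsTopGenerator γ)]
      (𝔭 : IsDedekindDomain.HeightOneSpectrum (NumberField.RingOfIntegers K)),
      ((3 : ℕ) : NumberField.RingOfIntegers K) ∈ 𝔭.asIdeal →
      𝔭.asIdeal.ramificationIdx (NumberField.RingOfIntegers ℚ) = 1 →
      𝔭.asIdeal.inertiaDeg (NumberField.RingOfIntegers ℚ) = 1 →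
    ∀ (𝔭' : IsDedekindDomain.HeightOneSpectrum (NumberField.RingOfIntegers K)),
      ((3 : ℕ) : NumberField.RingOfIntegers K) ∈ 𝔭'.asIdeal → 𝔭' ≠ 𝔭 →
    ∀ (ι' : PadicAlgCl 3 ≃+* ℂ),
      Summit.BirchSwinnertonDyer.BirchSwinnertonDyer.Theorems.SchneiderFree.BranchInducesPrime 3 ι' 𝔭 →
    ∀ (ΩK : ℂ) (Ωp : ℂ_[3]) (Lf : UnrSeries 3), ΩK ≠ 0 → Ωp ≠ 0 →
      Literature.NumberTheory.EllipticCurves.IsBDPLFunction ι' 𝔭 κ γ Dt.f ΩK Ωp Lf →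
    ∃ k : ℕ, ((3 : ℕ) : UnrSeries 3) ^ k * Lf ∈
      (AcSelmer.XAc.charIdeal (W.baseChange K) 3 κ 𝔭' ∅ γ).map (PowerSeries.map (Halves.toUnr 3)) := by
  intro W _ _ hc N _ K _ _ Dt hO6 hsurj hr1 hN hK hH κ hκ γ hγ 𝔭 h3𝔭 he hf 𝔭' h3' hne ι' hι ΩK Ωp Lf hΩK hΩp hL
  obtain ⟨L, _instF, _instNF, _instA, κL, γL, 𝔓, 𝔓', η, hlift, hgen, hantiL⟩ :=
    h3 W hc K hK κ hκ γ hγ.out 𝔭 h3𝔭 he hf 𝔭' h3' hne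
  haveI : Fact (κL.IsTopGenerator γL) := ⟨hgen⟩
  obtain ⟨ΩK', Ωp', S, hΩK', hΩp', hS, hS0⟩ :=
    h4 W N K Dt hO6 hsurj hr1 hN hK hH κ hκ γ 𝔭 h3𝔭 he hf 𝔭' h3' hne ι' hι L κL 𝔓 𝔓' η hlift
  have hup := h5 W N K Dt hO6 hsurj hr1 hN hK hH κ hκ γ 𝔭 h3𝔭 he hf 𝔭' h3' hne ι' hι L κL γL 𝔓 𝔓' η hlift hantiL
    ΩK Ωp Lf hΩK hΩp hL ΩK' Ωp' S hΩK' hΩp' hS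
  exact h6 W N K Dt hO6 hsurj hr1 hN hK hH κ hκ γ 𝔭 h3𝔭 he hf 𝔭' h3' hne ι' hι L κL γL 𝔓 𝔓' η hlift hantiL
    ΩK Ωp Lf hΩK hΩp hL ΩK' Ωp' S hΩK' hΩp' hS hS0 hup

/-- **Composition.**  On cubic rows: the rational wall (T3–T6) and the μ-bit (T2) give the integral wall by
`3`-saturation in the UFD `R₀⟦T⟧` (`3 = C 3` prime; a series with a norm-one coefficient is not divisible by `3`;
LANDED lemmas of `RatwallThinComb`, as in g3's `toothwise_kolyvagin_mu`); off cubic rows: T1.  Concludes the crux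
`AdditiveSplitIMCInclusionAtThree` BY NAME.  [folklore; Washington1997 §7.1] -/
theorem AdditiveSplitIMCInclusionAtThree_of :
    WallOffCubicRows → SelfMuZeroOnCubicRows → CubicLiftExists → ShadowPairExists → LiftedRationalInclusion →
      CubicDescent → AdditiveSplitIMCInclusionAtThree := by
  intro h1 h2 h3 h4 h5 h6 W _ _ N _ K _ _ Dt hO6 hsurj hr1 hN hK hH κ hκ γ _ 𝔭 h3𝔭 he hf 𝔭' h3' hne ι' hι ΩK Ωp L
    hΩK hΩp hL
  by_cases hc : CubicRow W
  · obtain ⟨k, hk⟩ := ratwall_on_cubic_rows h3 h4 h5 h6 W hc N K Dt hO6 hsurj hr1 hN hK hH κ hκ γ 𝔭 h3𝔭 he hf 𝔭'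
      h3' hne ι' hι ΩK Ωp L hΩK hΩp hL
    obtain ⟨-, g, hg, i, hi⟩ := h2 W hc N K Dt hO6 hsurj hr1 hN hK hH κ hκ γ 𝔭 h3𝔭 he hf 𝔭' h3' hne
    rw [hg] at hk ⊢
    have hdvd : g ∣ ((3 : ℕ) : UnrSeries 3) ^ k * L := Ideal.mem_span_singleton.mp hk
    rw [← map_natCast (PowerSeries.C (R := unrIntegers 3))] at hdvd
    exact Ideal.span_singleton_le_span_singleton.mpr
      (dvd_of_dvd_prime_pow_mul prime_C_three (not_C_three_dvd_of_norm_coeff_eq_one hi) k hdvd)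
  · exact h1 W hc N K Dt hO6 hsurj hr1 hN hK hH κ hκ γ 𝔭 h3𝔭 he hf 𝔭' h3' hne ι' hι ΩK Ωp L hΩK hΩp hL

end Summit.BirchSwinnertonDyer.BirchSwinnertonDyer.Cruxes.AdditiveSplitIMCInclusionAtThree.CubicUnwinding

end
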